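import Mathlib
import Summits.AtomisticToContinuum.HydrodynamicLimit.Theses.AntiMazurCoboundaries
import Literature.MathematicalPhysics.KineticTheory.RegularStationaryState

/-!
# Sketch — crux idea `cesaro-tilt-compactness` (crux stmt-AtomisticToContinuum-14135, round 2, ideator 6)

First checkable statements of the line "move the window average onto the STATE, then take local
limits": (1) three exact finite-`N` facts about the Cesàro-averaged density of a tilt along a
measure-preserving hard-sphere flow (bias identity, entropy monotonicity, total-variation
almost-invariance with the explicit rate `2u/h`); (2) the first-moment fast-energy bound under an
entropy budget (the provable core of the `NoInfluxFromInfinity` stub); (3) the infinite-volume wall in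
RATIO form, `FastBiasEntropyRatioBound`, typed over the tree's `RegularStationaryState` vocabulary.
Nothing is proved here; every `def … : Prop` only has to elaborate.
-/

noncomputable section

open MeasureTheory ProbabilityTheory InformationTheory Set Filter
open scoped ENNReal NNReal

namespace Summit.AtomisticToContinuum.HydrodynamicLimit.Cruxes.CorrectorPressureDecay.CesaroTiltCompactness

open Literature.MathematicalPhysics.KineticTheory (T3 V3 hsDiameter localGibbsLaw)
open Literature.MathematicalPhysics.KineticTheory.PointProcess (density markMoment specificRelEntropy)
open Literature.Analysis.FluidPDE (HardSphereFlow Config InfiniteHardSphereFlow IsHardSphereGibbs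
  IsTranslationInvariant)
open Literature.Analysis.FunctionSpaces (PointConfig)

/-- Phase space of `N + 1` labelled spheres on `𝕋³`. -/
abbrev Phase (N : ℕ) : Type := Config (N + 1) (Fin 3) T3

/-- A hard-sphere flow of `N + 1` spheres of diameter `ε` on `𝕋³`. -/
abbrev Flow (ε : ℝ) (N : ℕ) : Type := HardSphereFlow (Literature.Analysis.FluidPDE.Torus.geometry (Fin 3)) ε (N + 1)

/-- The CESÀRO DENSITY of a density `ρ` along the flow over the window `[0, h]`:
`ρ̄(z) = h⁻¹ ∫₀ʰ ρ(Φ_{-s} z) ds`, i.e. the density (w.r.t. an invariant law `μ`) of the time-averaged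
state `h⁻¹ ∫₀ʰ (Φ_s)_# (ρ μ) ds`. -/
def cesaroDensity {ε : ℝ} {N : ℕ} (Φ : Flow ε N) (h : ℝ) (ρ : Phase N → ℝ) : Phase N → ℝ :=
  fun z => h⁻¹ * ∫ s in (0 : ℝ)..h, ρ (Φ.flow (-s) z)

/-- **(1a) Bias identity** (moving the window average from the observable onto the state; Fubini +
invariance): `∫ (h⁻¹∫₀ʰ F∘Φ_s ds) ρ dμ = ∫ F ρ̄ dμ`. -/
def CesaroBiasIdentity : Prop :=
  ∀ (ε : ℝ) (N : ℕ) (Φ : Flow ε N) (μ : Measure (Phase N)), IsProbabilityMeasure μ →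
    (∀ t, MeasurePreserving (Φ.flow t) μ μ) → μ Φ.goodᶜ = 0 →
    ∀ (F ρ : Phase N → ℝ), Measurable F → Measurable ρ → (∃ C : ℝ, ∀ z, |F z| ≤ C) →
      (∃ C : ℝ, ∀ z, |ρ z| ≤ C) → ∀ h : ℝ, 0 < h →
        ∫ z, (h⁻¹ * ∫ s in (0 : ℝ)..h, F (Φ.flow s z)) * ρ z ∂μ = ∫ z, F z * cesaroDensity Φ h ρ z ∂μ

/-- **(1b) Entropy monotonicity** (Jensen for `x log x` + invariance): the Cesàro state has no more
relative entropy than the state, `∫ ρ̄ log ρ̄ dμ ≤ ∫ ρ log ρ dμ`. -/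
def CesaroEntropyLe : Prop :=
  ∀ (ε : ℝ) (N : ℕ) (Φ : Flow ε N) (μ : Measure (Phase N)), IsProbabilityMeasure μ →
    (∀ t, MeasurePreserving (Φ.flow t) μ μ) → μ Φ.goodᶜ = 0 →
    ∀ ρ : Phase N → ℝ, Measurable ρ → (∀ z, 0 ≤ ρ z) → (∃ C : ℝ, ∀ z, ρ z ≤ C) →
      ∫ z, ρ z ∂μ = 1 → ∀ h : ℝ, 0 < h →
        ∫ z, cesaroDensity Φ h ρ z * Real.log (cesaroDensity Φ h ρ z) ∂μ ≤ ∫ z, ρ z * Real.log (ρ z) ∂μ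

/-- **(1c) Total-variation almost-invariance with rate `2u/h`** (telescoping of the two windows
`[u, h+u]` and `[0, h]`): `‖(Φ_u)_#(ρ̄μ) − ρ̄μ‖_TV = ∫ |ρ̄∘Φ_{-u} − ρ̄| dμ ≤ 2u/h`. This is what makes
every local limit of Cesàro-averaged tilts EXACTLY invariant as `h → ∞`, at finite `N` and for free. -/
def CesaroAlmostInvariance : Prop :=
  ∀ (ε : ℝ) (N : ℕ) (Φ : Flow ε N) (μ : Measure (Phase N)), IsProbabilityMeasure μ →
    (∀ t, MeasurePreserving (Φ.flow t) μ μ) → μ Φ.goodᶜ = 0 →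
    ∀ ρ : Phase N → ℝ, Measurable ρ → (∀ z, 0 ≤ ρ z) → (∃ C : ℝ, ∀ z, ρ z ≤ C) →
      ∫ z, ρ z ∂μ = 1 → ∀ h u : ℝ, 0 < h → 0 ≤ u → u ≤ h →
        ∫ z, |cesaroDensity Φ h ρ (Φ.flow (-u) z) - cesaroDensity Φ h ρ z| ∂μ ≤ 2 * u / h

/-- **(2) Fast energy under an entropy budget** (provable core of `NoInfluxFromInfinity`; entropy
inequality against the invariant Gibbs law + the product formula for velocity-only exponential
moments): a state of relative entropy `≤ H(N+1)` w.r.t. `G_N` contains, in mean, at most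
`(N+1)(H+1)·8θ/U²` particles of peculiar speed `≥ U` (for `U ≥ 4√θ`). Being fast is not contagious:
this bound holds at EVERY time for the evolved state (same entropy, same invariant reference), so an
entropy-bounded state cannot sustain an influx of energetic carriers from distance `R` over a window
`h` except at time-averaged intensity `O(H s²θ/R² )`. -/
def FastEnergyUnderEntropyBound : Prop :=
  ∀ (a θ : ℝ) (u₀ : V3), 0 < a → 0 < θ → ∀ σ : ℝ, 0 < σ → σ ≤ 1 / 2 →
    ∀ (N : ℕ) (Φ : Flow (hsDiameter σ N) N) (ρ : Phase N → ℝ), Measurable ρ → (∀ z, 0 ≤ ρ z) →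
      (∃ C : ℝ, ∀ z, ρ z ≤ C) →
      ∫ z, ρ z ∂(localGibbsLaw σ (fun _ => a) (fun _ => u₀) (fun _ => θ) N Φ) = 1 →
      ∀ H U : ℝ, 0 ≤ H → 4 * Real.sqrt θ ≤ U →
        ∫ z, ρ z * Real.log (ρ z) ∂(localGibbsLaw σ (fun _ => a) (fun _ => u₀) (fun _ => θ) N Φ)
            ≤ H * (N + 1) →
        ∫ z, ((Finset.univ.filter fun i : Fin (N + 1) => U ≤ ‖(z i).2 - u₀‖).card : ℝ) * ρ z
            ∂(localGibbsLaw σ (fun _ => a) (fun _ => u₀) (fun _ => θ) N Φ)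
          ≤ (N + 1) * (H + 1) * (8 * θ / U ^ 2)

/-- **(3) THE WALL, ratio form** (`FastBiasEntropyRatioBound`; infinite volume, blown-up units:
diameter `1`, reference Gibbs state `g_ref = g_(z, β, u₀)` of density `< η₀`): for every regular
stationary state `μ` of an equilibrium (Alexander) flow in the dilute regime and every bounded fast
one-body observable `g` (orthogonal to `1, w, |w|²` under the standard Gaussian, applied to the reduced
velocity `√β (v − u₀)`), the one-body `g`-bias per unit volume is at most `C` times the specific
relative entropy of `μ` w.r.t. `g_ref`. Gibbs mixtures (other temperatures / drifts / densities)
satisfy it with the constant behind the certified `∃κ` threshold; the claim is that NO regular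
stationary state carries a FIRST-order fast distortion (the tangent-cone form of kinetic
flux-Gibbsianity). False for the free gas (`σ = 0`: every product state is stationary, ratio `= ∞`)
and false without the orthogonality clauses (boosted / heated Gibbs states, ratio `= ∞`). -/
def FastBiasEntropyRatioBound : Prop :=
  ∀ (β : ℝ) (u₀ : V3), 0 < β → ∃ η₀ : ℝ≥0∞, 0 < η₀ ∧ ∃ C : ℝ≥0,
    ∀ (z : ℝ) (g_ref : Measure (PointConfig (V3 × V3))), 0 < z → IsHardSphereGibbs 1 z β u₀ g_ref →
      IsTranslationInvariant g_ref → density g_ref < η₀ →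
    ∀ Φ : InfiniteHardSphereFlow (Fin 3) 1, Φ.IsEquilibriumFlow →
    ∀ μ : Measure (PointConfig (V3 × V3)),
      Literature.MathematicalPhysics.KineticTheory.RegularStationaryState Φ μ → density μ < η₀ →
    ∀ g : V3 → ℝ, Continuous g → (∀ w, |g w| ≤ 1) →
      (∀ (c₀ c₂ : ℝ) (b : V3), ∫ w, g w * (c₀ + inner ℝ b w + c₂ * ‖w‖ ^ 2) ∂(stdGaussian V3) = 0) →
      markMoment μ (fun v => ENNReal.ofReal (g ((Real.sqrt β) • (v - u₀))))
          ≤ markMoment μ (fun v => ENNReal.ofReal (-g ((Real.sqrt β) • (v - u₀)))) +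
            C * specificRelEntropy μ g_ref ∧
      markMoment μ (fun v => ENNReal.ofReal (-g ((Real.sqrt β) • (v - u₀))))
          ≤ markMoment μ (fun v => ENNReal.ofReal (g ((Real.sqrt β) • (v - u₀)))) +
            C * specificRelEntropy μ g_ref

/-- Sanity composition at the level of shapes (no content): the three finite-`N` facts are exactly
what turns the Gibbs variational formula for the window pressure into a STATIC one-body functional of
an almost-invariant state. Recorded as a conjunction so the crux-plan seat can import one name. -/
def CesaroStatePackage : Prop :=
  CesaroBiasIdentity ∧ CesaroEntropyLe ∧ CesaroAlmostInvariance

end Summit.AtomisticToContinuum.HydrodynamicLimit.Cruxes.CorrectorPressureDecay.CesaroTiltCompactness
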